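import Mathlib
import HarnessLib
import Summits.QuantumFields.YangMills.Theorems.PencilRigidityWeakCouplingHypercubicLimitStubMirrorOfRPSpectral
import Summits.QuantumFields.YangMills.Theorems.PencilRigidityWeakCouplingHypercubicLimitStubMirrorDomination
import Summits.QuantumFields.YangMills.Theorems.PencilRigidityWeakCouplingHypercubicLimitStubRpSpectralAnti
import Summits.QuantumFields.YangMills.Theorems.PencilRigidityWeakCouplingHypercubicLimitStubConvexWindow

/-!
# `RPSpectral ⇒ HasLatticeMassGap` — the window toolkit (crux `WeakCouplingHypercubicLimit`, stmt-QuantumFields-16120, line `Sketch`, r14, stub K5, part 1)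

Registered stub `stub_gapOfRPSpectral` of the lead's skeleton r14 (continuation lead c6):

  `RPSpectral r sch Δ C → (∀ᶠ k, 0 ≤ β_k) → HasLatticeMassGap r sch (Δ / 2)`

— the RP-spectral RELATIVE clustering of reflected slab functionals at separations `n < S/2` on all tori `S ≥ L_k`
(clause (b) of `IRInputs`, `RPSpectral`) already implies the volume-uniform lattice mass gap for ALL pairs of local
gauge-invariant observables at ALL separations `n ≤ S` (clause (a), `HasLatticeMassGap`), at half the rate.  No spectral
theory is used; the window `n ∈ (S/2, S]` that the c3/c5 census of this crux could not reach is closed by reflection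
positivity of Wilson's action on the ODD torus (landed for stmt-9442, `…Theorems.FiniteSusceptibilityWeakCoupling`):

* K2 `stub_mirrorOfRPSpectral` — `RPSpectral` read on the mirror correlator `D_P(m) = ⟨P · τ_m(P∘Θ)⟩ − ⟨P⟩⟨P∘Θ⟩` at the
  short lags `c ≤ m`, `2(m + c) ≤ S`;
* `MirrorLogConvex.mirrorCorr_nonneg` / `mirrorCorr_sq_le` — `D_P ≥ 0` and `D_P` is log-convex with step one on the long
  lag range (odd-torus RP + Cauchy–Schwarz), `mirrorCorr_fold'` — `D_P(2S+1−m) = D_{Pᴿ}(m)`;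
* K3 `stub_convexWindow` — a non-negative step-one log-convex sequence is bounded on an interval by its two end values;
* K4 `stub_mirrorDomination` — `⟨A; τ_n B⟩² ≤ (D_A(j₁) + D_{Aᴿ}(j₁)) · D_{Bᴿ}(j₂)` with `j₁, j₂ ∈ [n−1, S]`.

`mirror_window` assembles the per-species bound `|D_P(j)| ≤ (2e^{Δ(2c+3)} + C₀) B² e^{−(Δ/2) a_k j}` for `c ≤ j ≤ S`
(below the pivot `m₀ = S/2 − c − 1` by K2, on `[m₀, 2S+1−m₀] ∋ j` by K3 with both ends bounded by K2 for `P` and `Pᴿ`),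
and `stub_gapOfRPSpectral` (part 2, `…StubGapOfRPSpectral.lean`) combines it for `A, Aᴿ, Bᴿ` with K4 (small lags by the
a-priori bound `2B₀²`).  This file: the exponential bookkeeping, the a-priori bound and `mirror_window`.

Refs: K. Osterwalder, E. Seiler, Ann. Phys. 110 (1978) 440, §2; E. Seiler, LNP 159 (1982) Ch. 2. [folklore]
-/

noncomputable section

open MeasureTheory ProbabilityTheory Filter Topology
open Literature.MathematicalPhysics.QuantumFieldTheory hiding Site ZdEdge
open Literature.MathematicalPhysics.QuantumLattice
open Literature.MathematicalPhysics.AQFT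
open Summit.QuantumFields.YangMills.Cruxes.HypercubicLimit.CouplingResponse
open Summit.QuantumFields.YangMills.Theorems.FiniteSusceptibilityWeakCoupling
open Summit.QuantumFields.YangMills.Theorems.FiniteSusceptibilityWeakCoupling.MirrorDominationAxis0
open Summit.QuantumFields.YangMills.Theorems.FiniteSusceptibilityWeakCoupling.MirrorLogConvex

namespace Summit.QuantumFields.YangMills.Theorems.WeakCouplingHypercubicLimit.TraceNormColdPressure

namespace GapOfRPSpectral

/-! ## Exponential bookkeeping -/

/-- Below the pivot: `2B² e^{−Δa(j−c)} + C₀B² e^{−ΔaS} ≤ (2e^{Δ(2c+3)} + C₀) B² e^{−(Δ/2) a j}` for `j ≤ S`,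
`0 < a ≤ 1`, `Δ, C₀ ≥ 0`. [folklore] -/
theorem exp_low {Δ a B C₀ : ℝ} {c j S : ℕ} (hΔ : 0 ≤ Δ) (ha : 0 < a) (ha1 : a ≤ 1) (hC : 0 ≤ C₀)
    (hjS : j ≤ S) :
    2 * B ^ 2 * Real.exp (-(Δ * a * ((j : ℝ) - c))) + C₀ * B ^ 2 * Real.exp (-(Δ * a * S)) ≤
      (2 * Real.exp (Δ * (2 * c + 3)) + C₀) * B ^ 2 * Real.exp (-(Δ / 2 * (a * j))) := by
  have hB : 0 ≤ B ^ 2 := sq_nonneg B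
  have hc : (0 : ℝ) ≤ c := Nat.cast_nonneg c
  have hj : (0 : ℝ) ≤ j := Nat.cast_nonneg j
  have hjS' : (j : ℝ) ≤ S := by exact_mod_cast hjS
  have ht0 : 0 ≤ Δ * a := mul_nonneg hΔ ha.le
  have htΔ : Δ * a ≤ Δ := by nlinarith
  have htj : 0 ≤ Δ * a * j := mul_nonneg ht0 hj
  have htc : Δ * a * c ≤ Δ * c := mul_le_mul_of_nonneg_right htΔ hc
  have htjS : Δ * a * j ≤ Δ * a * S := mul_le_mul_of_nonneg_left hjS' ht0
  have h1 : Real.exp (-(Δ * a * ((j : ℝ) - c))) ≤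
      Real.exp (Δ * (2 * c + 3)) * Real.exp (-(Δ / 2 * (a * j))) := by
    rw [← Real.exp_add]
    refine Real.exp_le_exp.2 ?_
    have hΔc : 0 ≤ Δ * c := mul_nonneg hΔ hc
    nlinarith
  have h2 : Real.exp (-(Δ * a * S)) ≤ Real.exp (-(Δ / 2 * (a * j))) := by
    refine Real.exp_le_exp.2 ?_
    nlinarith
  have hE : 0 ≤ Real.exp (-(Δ / 2 * (a * j))) := Real.exp_nonneg _
  calc 2 * B ^ 2 * Real.exp (-(Δ * a * ((j : ℝ) - c))) + C₀ * B ^ 2 * Real.exp (-(Δ * a * S))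
      ≤ 2 * B ^ 2 * (Real.exp (Δ * (2 * c + 3)) * Real.exp (-(Δ / 2 * (a * j)))) +
          C₀ * B ^ 2 * Real.exp (-(Δ / 2 * (a * j))) := by
        gcongr
    _ = (2 * Real.exp (Δ * (2 * c + 3)) + C₀) * B ^ 2 * Real.exp (-(Δ / 2 * (a * j))) := by ring

/-- Inside the window: the end value at the pivot `m₀` (with `S ≤ 2m₀ + 2c + 3`) is
`≤ (2e^{Δ(2c+3)} + C₀) B² e^{−(Δ/2) a j}` for every `j ≤ S`. [folklore] -/
theorem exp_high {Δ a B C₀ : ℝ} {c j S m₀ : ℕ} (hΔ : 0 ≤ Δ) (ha : 0 < a) (ha1 : a ≤ 1) (hC : 0 ≤ C₀)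
    (hjS : j ≤ S) (hm : S ≤ 2 * m₀ + 2 * c + 3) :
    2 * B ^ 2 * Real.exp (-(Δ * a * ((m₀ : ℝ) - c))) + C₀ * B ^ 2 * Real.exp (-(Δ * a * S)) ≤
      (2 * Real.exp (Δ * (2 * c + 3)) + C₀) * B ^ 2 * Real.exp (-(Δ / 2 * (a * j))) := by
  have hB : 0 ≤ B ^ 2 := sq_nonneg B
  have hc : (0 : ℝ) ≤ c := Nat.cast_nonneg c
  have hj : (0 : ℝ) ≤ j := Nat.cast_nonneg j
  have hjS' : (j : ℝ) ≤ S := by exact_mod_cast hjS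
  have hm' : (S : ℝ) ≤ 2 * m₀ + 2 * c + 3 := by exact_mod_cast hm
  have ht0 : 0 ≤ Δ * a := mul_nonneg hΔ ha.le
  have htΔ : Δ * a ≤ Δ := by nlinarith
  have htj : 0 ≤ Δ * a * j := mul_nonneg ht0 hj
  have htc : Δ * a * c ≤ Δ * c := mul_le_mul_of_nonneg_right htΔ hc
  have htjS : Δ * a * j ≤ Δ * a * S := mul_le_mul_of_nonneg_left hjS' ht0
  have htS : Δ * a * S ≤ Δ * a * (2 * m₀ + 2 * c + 3) := mul_le_mul_of_nonneg_left hm' ht0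
  have h1 : Real.exp (-(Δ * a * ((m₀ : ℝ) - c))) ≤
      Real.exp (Δ * (2 * c + 3)) * Real.exp (-(Δ / 2 * (a * j))) := by
    rw [← Real.exp_add]
    refine Real.exp_le_exp.2 ?_
    have hΔc : 0 ≤ Δ * c := mul_nonneg hΔ hc
    nlinarith
  have h2 : Real.exp (-(Δ * a * S)) ≤ Real.exp (-(Δ / 2 * (a * j))) := by
    refine Real.exp_le_exp.2 ?_
    nlinarith
  have hE : 0 ≤ Real.exp (-(Δ / 2 * (a * j))) := Real.exp_nonneg _
  calc 2 * B ^ 2 * Real.exp (-(Δ * a * ((m₀ : ℝ) - c))) + C₀ * B ^ 2 * Real.exp (-(Δ * a * S))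
      ≤ 2 * B ^ 2 * (Real.exp (Δ * (2 * c + 3)) * Real.exp (-(Δ / 2 * (a * j)))) +
          C₀ * B ^ 2 * Real.exp (-(Δ / 2 * (a * j))) := by
        gcongr
    _ = (2 * Real.exp (Δ * (2 * c + 3)) + C₀) * B ^ 2 * Real.exp (-(Δ / 2 * (a * j))) := by ring

/-- Enlarging the offset `c' ≤ c` only weakens the short-lag bound (`Δ a ≥ 0`). [folklore] -/
theorem shortLag_mono {Δ a B C₀ E : ℝ} {c c' m : ℕ} (hΔa : 0 ≤ Δ * a) (hcc : c' ≤ c) {x : ℝ}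
    (h : x ≤ 2 * B ^ 2 * Real.exp (-(Δ * a * ((m : ℝ) - c'))) + C₀ * B ^ 2 * E) :
    x ≤ 2 * B ^ 2 * Real.exp (-(Δ * a * ((m : ℝ) - c))) + C₀ * B ^ 2 * E := by
  refine h.trans (add_le_add ?_ le_rfl)
  have hB : 0 ≤ 2 * B ^ 2 := by positivity
  refine mul_le_mul_of_nonneg_left (Real.exp_le_exp.2 ?_) hB
  have hcc' : (c' : ℝ) ≤ c := by exact_mod_cast hcc
  nlinarith

/-! ## The a-priori bound on a connected correlation -/

section Lattice

variable {G : Type} [Group G] [TopologicalSpace G] [IsTopologicalGroup G] [CompactSpace G]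
  [MeasurableSpace G] [BorelSpace G]

/-- `|⟨f g⟩ − ⟨f⟩⟨g⟩| ≤ 2B²` for `|f|, |g| ≤ B` under a probability measure. [folklore] -/
theorem abs_sub_mul_le {Ω : Type*} [MeasurableSpace Ω] {μ : Measure Ω} [IsProbabilityMeasure μ]
    {f g h : Ω → ℝ} {B : ℝ} (hf : ∀ ω, |f ω| ≤ B) (hg : ∀ ω, |g ω| ≤ B) (hh : ∀ ω, |h ω| ≤ B) :
    |(∫ ω, f ω * g ω ∂μ) - (∫ ω, f ω ∂μ) * (∫ ω, h ω ∂μ)| ≤ 2 * B ^ 2 := by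
  obtain ⟨ω₀⟩ := nonempty_of_isProbabilityMeasure μ
  have hB : 0 ≤ B := (abs_nonneg _).trans (hf ω₀)
  have h1 : |∫ ω, f ω * g ω ∂μ| ≤ B * B := by
    have := norm_integral_le_of_norm_le_const (μ := μ) (f := fun ω => f ω * g ω) (C := B * B)
      (Eventually.of_forall fun ω => by
        rw [Real.norm_eq_abs, abs_mul]
        exact mul_le_mul (hf ω) (hg ω) (abs_nonneg _) hB)
    simpa [Real.norm_eq_abs] using this
  have h2 : |∫ ω, f ω ∂μ| ≤ B := by
    have := norm_integral_le_of_norm_le_const (μ := μ) (f := f) (C := B)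
      (Eventually.of_forall fun ω => by simpa [Real.norm_eq_abs] using hf ω)
    simpa [Real.norm_eq_abs] using this
  have h3 : |∫ ω, h ω ∂μ| ≤ B := by
    have := norm_integral_le_of_norm_le_const (μ := μ) (f := h) (C := B)
      (Eventually.of_forall fun ω => by simpa [Real.norm_eq_abs] using hh ω)
    simpa [Real.norm_eq_abs] using this
  have h4 : |(∫ ω, f ω ∂μ) * (∫ ω, h ω ∂μ)| ≤ B * B := by
    rw [abs_mul]; exact mul_le_mul h2 h3 (abs_nonneg _) hB
  calc |(∫ ω, f ω * g ω ∂μ) - (∫ ω, f ω ∂μ) * (∫ ω, h ω ∂μ)|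
      ≤ |∫ ω, f ω * g ω ∂μ| + |(∫ ω, f ω ∂μ) * (∫ ω, h ω ∂μ)| := abs_sub _ _
    _ ≤ B * B + B * B := add_le_add h1 h4
    _ = 2 * B ^ 2 := by ring

/-- The a-priori bound `|⟨A; τ_n B⟩_{β,2S+1}| ≤ 2B₀²` for observables bounded by `B₀`. [folklore] -/
theorem abs_latticeConnectedCorr_le (r : LatticeRep G) (β : ℝ) (S n : ℕ) {A B : LGConfig 4 G → ℝ} {B₀ : ℝ}
    (hA : ∀ V, |A V| ≤ B₀) (hB : ∀ V, |B V| ≤ B₀) :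
    |latticeConnectedCorr r.ρ β (2 * S + 1) A B n| ≤ 2 * B₀ ^ 2 := by
  haveI : IsProbabilityMeasure (wilsonMeasure (d := 4) (L := 2 * S + 1) r.ρ β) :=
    isProbabilityMeasure_wilsonMeasure _ r.continuous β
  unfold latticeConnectedCorr
  exact abs_sub_mul_le (fun U => hA _) (fun U => hB _) (fun U => hB _)

/-! ## The window bound for one species -/

/-- **The window bound.**  At `β ≥ 0`, for a local gauge-invariant `P` of time radius `R` (`|t| + 2 ≤ R` on `supp P`), if the
short-lag bound `|D(m)| ≤ 2B² e^{−Δa(m−c)} + C₀B² e^{−ΔaS}` (`c ≤ m`, `2(m + c) ≤ S`) holds for BOTH mirror correlators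
`D_P(m) = ⟨P; τ_m(P∘Θ)⟩` and `D_{Pᴿ}(m) = ⟨P∘Θ; τ_m P⟩`, then `|D_P(j)| ≤ (2e^{Δ(2c+3)} + C₀) B² e^{−(Δ/2) a j}` for ALL
`c ≤ j ≤ S` (`S ≥ 4c + 4R + 12`, `0 < a ≤ 1`): below the pivot `m₀ = S/2 − c − 1` directly, on `[m₀, 2S+1−m₀] ∋ j` by the
discrete maximum principle `stub_convexWindow` for the non-negative step-one log-convex sequence `D_P`
(`mirrorCorr_nonneg`, `mirrorCorr_sq_le`), whose two end values `D_P(m₀)` and `D_P(2S+1−m₀) = D_{Pᴿ}(m₀)` (`mirrorCorr_fold'`)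
are short-lag values. [folklore] -/
theorem mirror_window (r : LatticeRep G) {β : ℝ} (hβ : 0 ≤ β) (P : YMSpecies G) {R : ℕ}
    (hR : ∀ e ∈ P.supp, (e.1 0).natAbs + 2 ≤ R) {Δ a B C₀ : ℝ} (hΔ : 0 ≤ Δ) (ha : 0 < a) (ha1 : a ≤ 1)
    (hC : 0 ≤ C₀) {c S : ℕ} (hS : 4 * c + 4 * R + 12 ≤ S)
    (hP : ∀ m : ℕ, c ≤ m → 2 * (m + c) ≤ S →
      |latticeConnectedCorr r.ρ β (2 * S + 1) P.F (fun V => P.F (cfgReflect V)) m| ≤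
        2 * B ^ 2 * Real.exp (-(Δ * a * ((m : ℝ) - c))) + C₀ * B ^ 2 * Real.exp (-(Δ * a * S)))
    (hQ : ∀ m : ℕ, c ≤ m → 2 * (m + c) ≤ S →
      |latticeConnectedCorr r.ρ β (2 * S + 1) (fun V => P.F (cfgReflect V)) P.F m| ≤
        2 * B ^ 2 * Real.exp (-(Δ * a * ((m : ℝ) - c))) + C₀ * B ^ 2 * Real.exp (-(Δ * a * S))) :
    ∀ j : ℕ, c ≤ j → j ≤ S →
      |latticeConnectedCorr r.ρ β (2 * S + 1) P.F (fun V => P.F (cfgReflect V)) j| ≤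
        (2 * Real.exp (Δ * (2 * c + 3)) + C₀) * B ^ 2 * Real.exp (-(Δ / 2 * (a * j))) := by
  intro j hcj hjS
  obtain ⟨m₀, hm₀⟩ : ∃ m₀ : ℕ, m₀ = S / 2 - c - 1 := ⟨_, rfl⟩
  have hm₀c : c ≤ m₀ := by omega
  have hm₀S : 2 * (m₀ + c) ≤ S := by omega
  have hm₀R : 2 * R + 1 ≤ m₀ := by omega
  have hm₀2 : S ≤ 2 * m₀ + 2 * c + 3 := by omega
  by_cases hj : j < m₀
  · exact (hP j hcj (by omega)).trans (exp_low hΔ ha ha1 hC hjS)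
  · have hj : m₀ ≤ j := not_lt.1 hj
    have hnonneg : ∀ i : ℕ, m₀ ≤ i → i ≤ 2 * S + 1 - m₀ →
        0 ≤ (fun i : ℕ => latticeConnectedCorr r.ρ β (2 * S + 1) P.F (fun V => P.F (cfgReflect V)) i) i :=
      fun i hi1 hi2 => mirrorCorr_nonneg r hβ P hR (by omega) (by omega)
    have hconv : ∀ i : ℕ, m₀ + 1 ≤ i → i + 1 ≤ 2 * S + 1 - m₀ →
        (fun i : ℕ => latticeConnectedCorr r.ρ β (2 * S + 1) P.F (fun V => P.F (cfgReflect V)) i) i ^ 2 ≤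
          (fun i : ℕ => latticeConnectedCorr r.ρ β (2 * S + 1) P.F (fun V => P.F (cfgReflect V)) i) (i - 1) *
            (fun i : ℕ => latticeConnectedCorr r.ρ β (2 * S + 1) P.F (fun V => P.F (cfgReflect V)) i) (i + 1) :=
      fun i hi1 hi2 => mirrorCorr_sq_le r hβ P hR (by omega) (by omega)
    have hlo : (fun i : ℕ => latticeConnectedCorr r.ρ β (2 * S + 1) P.F (fun V => P.F (cfgReflect V)) i) m₀ ≤
        2 * B ^ 2 * Real.exp (-(Δ * a * ((m₀ : ℝ) - c))) + C₀ * B ^ 2 * Real.exp (-(Δ * a * S)) :=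
      (le_abs_self _).trans (hP m₀ hm₀c hm₀S)
    have hhi : (fun i : ℕ => latticeConnectedCorr r.ρ β (2 * S + 1) P.F (fun V => P.F (cfgReflect V)) i)
        (2 * S + 1 - m₀) ≤
        2 * B ^ 2 * Real.exp (-(Δ * a * ((m₀ : ℝ) - c))) + C₀ * B ^ 2 * Real.exp (-(Δ * a * S)) := by
      show latticeConnectedCorr r.ρ β (2 * S + 1) P.F (fun V => P.F (cfgReflect V)) (2 * S + 1 - m₀) ≤ _
      rw [mirrorCorr_fold' r β P (show m₀ ≤ 2 * S + 1 by omega)]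
      exact (le_abs_self _).trans (hQ m₀ hm₀c hm₀S)
    have hwin := stub_convexWindow
      (fun i : ℕ => latticeConnectedCorr r.ρ β (2 * S + 1) P.F (fun V => P.F (cfgReflect V)) i)
      m₀ (2 * S + 1 - m₀) _ (by omega) hnonneg hconv hlo hhi j hj (by omega)
    have hj0 := hnonneg j hj (by omega)
    simp only [] at hwin hj0
    rw [abs_of_nonneg hj0]
    exact hwin.trans (exp_high hΔ ha ha1 hC hjS hm₀2)

omit [CompactSpace G] in
/-- Time radius of the mirror species in the `+ 2` format: `|t| + 2 ≤ R + 1` on `supp Pᴿ`. [folklore] -/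
theorem radius_reflSpecies_succ (P : YMSpecies G) {R : ℕ} (hR : ∀ e ∈ P.supp, (e.1 0).natAbs + 2 ≤ R) :
    ∀ e ∈ (reflSpecies P).supp, (e.1 0).natAbs + 2 ≤ R + 1 := by
  intro e he
  have h := radius_reflSpecies P (k := 1) hR e he
  omega

omit [CompactSpace G] in
/-- `(Pᴿ)ᴿ = P` at the level of observables, as a function identity. [folklore] -/
theorem reflSpecies_reflSpecies_F_eq (P : YMSpecies G) :
    (fun V => (reflSpecies P).F (cfgReflect V)) = P.F :=
  funext fun V => reflSpecies_reflSpecies_F P V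

end Lattice

end GapOfRPSpectral

open GapOfRPSpectral in
/-- **Registered sub-goal `mirrorWindow` (line `Sketch`, r14; closed form of `GapOfRPSpectral.mirror_window`)**: the per-species
window bound — at `β ≥ 0`, short-lag bounds on both mirror correlators of a local gauge-invariant `P` give
`|D_P(j)| ≤ (2e^{Δ(2c+3)} + C₀) B² e^{−(Δ/2) a j}` for all `c ≤ j ≤ S` (`S ≥ 4c + 4R + 12`, `0 < a ≤ 1`). [folklore] -/
theorem mirrorWindow : ∀ (G : Type) [Group G] [TopologicalSpace G] [IsTopologicalGroup G] [CompactSpace G] [MeasurableSpace G] [BorelSpace G] (r : LatticeRep G) (β : ℝ), 0 ≤ β → ∀ (P : YMSpecies G) (R : ℕ), (∀ e ∈ P.supp, (e.1 0).natAbs + 2 ≤ R) → ∀ (Δ a B C₀ : ℝ), 0 ≤ Δ → 0 < a → a ≤ 1 → 0 ≤ C₀ → ∀ (c S : ℕ), 4 * c + 4 * R + 12 ≤ S → (∀ m : ℕ, c ≤ m → 2 * (m + c) ≤ S → |latticeConnectedCorr r.ρ β (2 * S + 1) P.F (fun V => P.F (cfgReflect V)) m| ≤ 2 * B ^ 2 *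 Real.exp (-(Δ * a * ((m : ℝ) - c))) + C₀ * B ^ 2 * Real.exp (-(Δ * a * S))) → (∀ m : ℕ, c ≤ m → 2 * (m + c) ≤ S → |latticeConnectedCorr r.ρ β (2 * S + 1) (fun V => P.F (cfgReflect V)) P.F m| ≤ 2 * B ^ 2 * Real.exp (-(Δ * a * ((m : ℝ) - c))) + C₀ * B ^ 2 * Real.exp (-(Δ * a * S))) → ∀ j : ℕ, c ≤ j → j ≤ S → |latticeConnectedCorr r.ρ β (2 * S + 1) P.F (fun V => P.F (cfgReflect V)) j| ≤ (2 * Real.exp (Δ * (2 * c + 3)) + C₀) * B ^ 2 * Real.exp (-(Δ / 2 * (a * j))) :=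
  fun _ _ _ _ _ _ _ r _ hβ P _ hR _ _ _ _ hΔ ha ha1 hC _ _ hS hP hQ => mirror_window r hβ P hR hΔ ha ha1 hC hS hP hQ

end Summit.QuantumFields.YangMills.Theorems.WeakCouplingHypercubicLimit.TraceNormColdPressure

end
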